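import Summits.Ventures.HSemireg.WedgeHankelRecurrenceGaussChebyshevAntiPeriods
import Mathlib.Data.Nat.Fib.Basic

/-!
# Venture HSemireg — **FIBONACCI AND LUCAS VALUES OF THE VIETA–LUCAS POLYNOMIALS: in every commutative ring `S_n(3) = F_{2n+2}` and `C_n(3) = L_{2n} = 2F_{2n+1} − F_{2n}`, `S_n(−3) = (−1)^n F_{2n+2}`,
# `C_n(−3) = (−1)^n L_{2n}`; for any `x` with `x² = 5`: `C_{2k}(x) = L_{2k}`, `C_{2k+1}(x) = F_{2k+1}·x`, `S_{2k}(x) = L_{2k+1}`, `S_{2k+1}(x) = F_{2k+2}·x`; over `ℝ` the trigonometric product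
# `F_{2n+2} = ∏_{k=1}^{n} (3 − 2cos(kπ∕(n+1)))`** (Lucas's law `U_{m(n+1)}∕U_m = S_n(V_m)` at `m = 2`, and `√5 = φ − ψ`)

HONEST FRAMING. Part of the Lean index of the computation cell `pub-hsemireg` (seat p10 gen 49, Sunday typer «UNIFORM-IN-n»).  Polynomial algebra over a commutative ring (Mathlib
`Polynomial.Chebyshev.S ∕ C`, `Nat.fib`) and the real product of N500; no variety, no cohomology theory, no sheaf, no Ext group and no semiregularity map is constructed here; nothing here says that
HC / HC_CM / HC_AV holds; no Literature fact (unproved `Prop`) is declared or used.  Custodian versions as in `WedgeHankelSiegelIdeal` (1/3).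
SOURCES (cited).  E. Lucas, *Théorie des fonctions numériques simplement périodiques*, Amer. J. Math. 1 (1878) 184–240, §§ 9–11 (`U_{mn} ∕ U_m` as a polynomial in `V_m`); P. Ribenboim, *My Numbers,
My Friends* (Springer 2000), Ch. 1, (2.8)–(2.10) and §4 (`U_n(3, 1) = F_{2n}`, `V_n(3, 1) = L_{2n}`); T. Koshy, *Fibonacci and Lucas Numbers with Applications* (Wiley 2001), Ch. 17 and identity
`F_n = ∏_{k=1}^{⌊(n−1)∕2⌋} (3 + 2cos(2kπ∕n))`-type trigonometric products (here in the `S_n` normalisation); N. Garnier, O. Ramaré, *Fibonacci numbers and trigonometric identities*, Fibonacci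
Quart. 46∕47 (2008∕09) 56–61.
PROOF TYPED HERE.  (1) `F_{m+4} + F_m = 3F_{m+2}` (Mathlib `Nat.fib_add_two` three times), so `n ↦ F_{2n+2}` and `n ↦ 2F_{2n+1} − F_{2n}` satisfy `a_{n+2} = 3a_{n+1} − a_n` with the initial values
of `S_n(3)` (`1, 3`) resp. `C_n(3)` (`2, 3`): two-step induction with `S_add_two ∕ C_add_two`; parity (N519 `chebyshevS_eval_neg`, `chebyshevC_eval_neg`) for `x = −3`; (2) for `x² = 5` the pairs
`(C_{2k}(x), C_{2k+1}(x))`, `(S_{2k}(x), S_{2k+1}(x))` by induction on `k` with `5F_{j+1} − L_j = L_{j+2}`, `L_{j+1} − F_j = F_{j+2}` (`linear_combination` on `Nat.fib_add_two`); (3) N500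
`chebyshevS_eq_prod_real` at `X = 3`.
DEDUP DISCLOSURE (`rg -ln Chebyshev Summits Literature | xargs rg -ln 'Nat.fib'` — no Chebyshev–Fibonacci file; `rg -n 'eval 3|eval \\(3' Summits/Ventures/HSemireg`, 2026-09-04): the tree's
`Literature/NumberTheory/LucasSequences/*` types the general `U_n(P,Q) ∕ V_n(P,Q)` theory (Binet, subsequences, law of repetition) and this chapter's N476 ∕ N483 read `gcd`s through it, but the
values of Mathlib's `Chebyshev.S ∕ C` at `3`, `−3`, `x² = 5` in terms of Mathlib's `Nat.fib` and the product for `F_{2n+2}` are not typed; Mathlib has `Nat.fib_add_two`, `Real.goldenRatio` Binet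
(`Real.coe_fib_eq`) but no Chebyshev link; 0 hits for the 10 names below.

WHAT IS IN THE TREE.  N519 `chebyshevS_eval_neg`, `chebyshevC_eval_neg`; N500 `chebyshevS_eq_prod_real`; Mathlib `Nat.fib_zero ∕ fib_one ∕ fib_two ∕ fib_add_two`, `S_add_two`, `C_add_two`,
`S_zero ∕ S_one ∕ C_zero ∕ C_one`, `Nat.twoStepInduction`.
THIS FILE (namespace `Summit.Ventures.HSemireg.Wedge.HankelOuter` continued; CHAINED on N525; 0 definitions):
* §1291 `fib_add_four_add_fib` (`F_{m+4} + F_m = 3F_{m+2}`), **`chebyshevS_eval_three`** (`S_n(3) = F_{2n+2}`), **`chebyshevC_eval_three`** (`C_n(3) = 2F_{2n+1} − F_{2n}`),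
  **`chebyshevS_eval_neg_three`**, **`chebyshevC_eval_neg_three`**, **`chebyshevC_eval_of_sq_eq_five`** (`C_{2k}(x) = 2F_{2k+1} − F_{2k}`, `C_{2k+1}(x) = F_{2k+1} x`),
  **`chebyshevS_eval_of_sq_eq_five`** (`S_{2k}(x) = 2F_{2k+2} − F_{2k+1}`, `S_{2k+1}(x) = F_{2k+2} x`), **`chebyshevC_eval_sqrt_five_odd`**, **`chebyshevS_eval_sqrt_five_odd`** (over `ℝ`, `x = √5`),
  **`fib_two_mul_add_two_eq_prod_cos`** (`F_{2n+2} = ∏_{k<n} (3 − 2cos((k+1)π∕(n+1)))`).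
CAVEATS.  Lucas numbers are written `L_j = 2F_{j+1} − F_j` (Mathlib has no `Nat.lucas`); all ring statements are cast from `ℕ` via `Nat.cast`.  Nothing Ext-side.  New names only.
-/

open Module Polynomial
open scoped Matrix Polynomial

namespace Summit.Ventures.HSemireg.Wedge.HankelOuter

/-! ## §1291. Fibonacci and Lucas values of `S_n`, `C_n` -/

/-- `F_{m+4} + F_m = 3F_{m+2}` (the bisection recurrence of the Fibonacci numbers). [Ribenboim 2000, Ch. 1 (2.8); this file, §1291] -/
theorem fib_add_four_add_fib (m : ℕ) : Nat.fib (m + 4) + Nat.fib m = 3 * Nat.fib (m + 2) := by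
  have h2 : Nat.fib (m + 2) = Nat.fib m + Nat.fib (m + 1) := Nat.fib_add_two
  have h3 : Nat.fib (m + 3) = Nat.fib (m + 1) + Nat.fib (m + 2) := Nat.fib_add_two
  have h4 : Nat.fib (m + 4) = Nat.fib (m + 2) + Nat.fib (m + 3) := Nat.fib_add_two
  omega

/-! ### `x = 3` and `x = −3` -/

/-- **`S_n(3) = F_{2n+2}`** in every commutative ring (`1, 3, 8, 21, 55, …`; Lucas: `U_{2(n+1)} ∕ U_2 = S_n(V_2)`). [Lucas 1878, §9; Ribenboim 2000, Ch. 1 §4; this file, §1291] -/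
theorem chebyshevS_eval_three {R : Type*} [CommRing R] (n : ℕ) : (Polynomial.Chebyshev.S R (n : ℤ)).eval 3 = (Nat.fib (2 * n + 2) : R) := by
  induction n using Nat.twoStepInduction with
  | zero => simp
  | one => simp [show Nat.fib 4 = 3 from rfl]
  | more n ih0 ih1 =>
    rw [show ((n + 2 : ℕ) : ℤ) = (n : ℤ) + 2 by push_cast; ring, Polynomial.Chebyshev.S_add_two, show (n : ℤ) + 1 = ((n + 1 : ℕ) : ℤ) by push_cast; ring,
      eval_sub, eval_mul, eval_X, ih0, ih1]
    have h := fib_add_four_add_fib (2 * n + 2)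
    rw [show 2 * n + 2 + 4 = 2 * (n + 2) + 2 by ring, show 2 * n + 2 + 2 = 2 * (n + 1) + 2 by ring] at h
    have h' : ((Nat.fib (2 * (n + 2) + 2) + Nat.fib (2 * n + 2) : ℕ) : R) = ((3 * Nat.fib (2 * (n + 1) + 2) : ℕ) : R) := by rw [h]
    push_cast at h'
    linear_combination -h'

/-- **`C_n(3) = L_{2n} = 2F_{2n+1} − F_{2n}`** in every commutative ring (`2, 3, 7, 18, 47, …`; Lucas: `V_{2n} = V_n(V_2)`). [Lucas 1878, §9; Ribenboim 2000, Ch. 1 §4; this file, §1291] -/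
theorem chebyshevC_eval_three {R : Type*} [CommRing R] (n : ℕ) : (Polynomial.Chebyshev.C R (n : ℤ)).eval 3 = 2 * (Nat.fib (2 * n + 1) : R) - (Nat.fib (2 * n) : R) := by
  induction n using Nat.twoStepInduction with
  | zero => norm_num
  | one => norm_num [show Nat.fib 3 = 2 from rfl]
  | more n ih0 ih1 =>
    rw [show ((n + 2 : ℕ) : ℤ) = (n : ℤ) + 2 by push_cast; ring, Polynomial.Chebyshev.C_add_two, show (n : ℤ) + 1 = ((n + 1 : ℕ) : ℤ) by push_cast; ring,
      eval_sub, eval_mul, eval_X, ih0, ih1]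
    have ha := fib_add_four_add_fib (2 * n + 1)
    have hb := fib_add_four_add_fib (2 * n)
    rw [show 2 * n + 1 + 4 = 2 * (n + 2) + 1 by ring, show 2 * n + 1 + 2 = 2 * (n + 1) + 1 by ring] at ha
    rw [show 2 * n + 4 = 2 * (n + 2) by ring, show 2 * n + 2 = 2 * (n + 1) by ring] at hb
    have ha' : ((Nat.fib (2 * (n + 2) + 1) + Nat.fib (2 * n + 1) : ℕ) : R) = ((3 * Nat.fib (2 * (n + 1) + 1) : ℕ) : R) := by rw [ha]
    have hb' : ((Nat.fib (2 * (n + 2)) + Nat.fib (2 * n) : ℕ) : R) = ((3 * Nat.fib (2 * (n + 1)) : ℕ) : R) := by rw [hb]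
    push_cast at ha' hb'
    linear_combination -2 * ha' + hb'

/-- **`S_n(−3) = (−1)^n F_{2n+2}`** in every commutative ring. [Ribenboim 2000, Ch. 1 §4; this file, §1291] -/
theorem chebyshevS_eval_neg_three {R : Type*} [CommRing R] (n : ℕ) : (Polynomial.Chebyshev.S R (n : ℤ)).eval (-3) = (-1) ^ n * (Nat.fib (2 * n + 2) : R) := by
  rw [chebyshevS_eval_neg, chebyshevS_eval_three]

/-- **`C_n(−3) = (−1)^n L_{2n}`** in every commutative ring. [Ribenboim 2000, Ch. 1 §4; this file, §1291] -/
theorem chebyshevC_eval_neg_three {R : Type*} [CommRing R] (n : ℕ) :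
    (Polynomial.Chebyshev.C R (n : ℤ)).eval (-3) = (-1) ^ n * (2 * (Nat.fib (2 * n + 1) : R) - (Nat.fib (2 * n) : R)) := by
  rw [chebyshevC_eval_neg, chebyshevC_eval_three]

/-! ### `x² = 5` (`x = φ − ψ = φ + φ⁻¹`) -/

/-- **For `x² = 5`: `C_{2k}(x) = L_{2k} = 2F_{2k+1} − F_{2k}` and `C_{2k+1}(x) = F_{2k+1}·x`** in every commutative ring (`t = φ`: `φ + φ⁻¹ = √5`, `C_n(√5) = φⁿ + (−ψ)ⁿ`).
[Koshy 2001, Ch. 17; Ribenboim 2000, Ch. 1; this file, §1291] -/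
theorem chebyshevC_eval_of_sq_eq_five {R : Type*} [CommRing R] {x : R} (hx : x ^ 2 = 5) (k : ℕ) :
    (Polynomial.Chebyshev.C R ((2 * k : ℕ) : ℤ)).eval x = 2 * (Nat.fib (2 * k + 1) : R) - (Nat.fib (2 * k) : R) ∧
      (Polynomial.Chebyshev.C R ((2 * k + 1 : ℕ) : ℤ)).eval x = (Nat.fib (2 * k + 1) : R) * x := by
  induction k with
  | zero => exact ⟨by norm_num, by simp⟩
  | succ k ih =>
    obtain ⟨ih0, ih1⟩ := ih
    have f2 : (Nat.fib (2 * k + 2) : R) = Nat.fib (2 * k) + Nat.fib (2 * k + 1) := by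
      have h : Nat.fib (2 * k + 2) = Nat.fib (2 * k) + Nat.fib (2 * k + 1) := Nat.fib_add_two
      rw [h, Nat.cast_add]
    have f3 : (Nat.fib (2 * k + 3) : R) = Nat.fib (2 * k + 1) + Nat.fib (2 * k + 2) := by
      have h : Nat.fib (2 * k + 3) = Nat.fib (2 * k + 1) + Nat.fib (2 * k + 2) := Nat.fib_add_two
      rw [h, Nat.cast_add]
    have heven : (Polynomial.Chebyshev.C R ((2 * (k + 1) : ℕ) : ℤ)).eval x = 2 * (Nat.fib (2 * (k + 1) + 1) : R) - (Nat.fib (2 * (k + 1)) : R) := by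
      rw [show ((2 * (k + 1) : ℕ) : ℤ) = ((2 * k : ℕ) : ℤ) + 2 by push_cast; ring, Polynomial.Chebyshev.C_add_two, show ((2 * k : ℕ) : ℤ) + 1 = ((2 * k + 1 : ℕ) : ℤ) by push_cast; ring,
        eval_sub, eval_mul, eval_X, ih1, ih0, show 2 * (k + 1) + 1 = 2 * k + 3 by ring, show 2 * (k + 1) = 2 * k + 2 by ring]
      linear_combination (Nat.fib (2 * k + 1) : R) * hx - 2 * f3 - f2
    refine ⟨heven, ?_⟩
    rw [show ((2 * (k + 1) + 1 : ℕ) : ℤ) = ((2 * k + 1 : ℕ) : ℤ) + 2 by push_cast; ring, Polynomial.Chebyshev.C_add_two, show ((2 * k + 1 : ℕ) : ℤ) + 1 = ((2 * (k + 1) : ℕ) : ℤ) by push_cast; ring,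
      eval_sub, eval_mul, eval_X, heven, ih1, show 2 * (k + 1) + 1 = 2 * k + 3 by ring, show 2 * (k + 1) = 2 * k + 2 by ring]
    linear_combination x * f3

/-- **For `x² = 5`: `S_{2k}(x) = L_{2k+1} = 2F_{2k+2} − F_{2k+1}` and `S_{2k+1}(x) = F_{2k+2}·x`** in every commutative ring. [Koshy 2001, Ch. 17; Ribenboim 2000, Ch. 1; this file, §1291] -/
theorem chebyshevS_eval_of_sq_eq_five {R : Type*} [CommRing R] {x : R} (hx : x ^ 2 = 5) (k : ℕ) :
    (Polynomial.Chebyshev.S R ((2 * k : ℕ) : ℤ)).eval x = 2 * (Nat.fib (2 * k + 2) : R) - (Nat.fib (2 * k + 1) : R) ∧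
      (Polynomial.Chebyshev.S R ((2 * k + 1 : ℕ) : ℤ)).eval x = (Nat.fib (2 * k + 2) : R) * x := by
  induction k with
  | zero => exact ⟨by norm_num, by simp⟩
  | succ k ih =>
    obtain ⟨ih0, ih1⟩ := ih
    have f3 : (Nat.fib (2 * k + 3) : R) = Nat.fib (2 * k + 1) + Nat.fib (2 * k + 2) := by
      have h : Nat.fib (2 * k + 3) = Nat.fib (2 * k + 1) + Nat.fib (2 * k + 2) := Nat.fib_add_two
      rw [h, Nat.cast_add]
    have f4 : (Nat.fib (2 * k + 4) : R) = Nat.fib (2 * k + 2) + Nat.fib (2 * k + 3) := by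
      have h : Nat.fib (2 * k + 4) = Nat.fib (2 * k + 2) + Nat.fib (2 * k + 3) := Nat.fib_add_two
      rw [h, Nat.cast_add]
    have heven : (Polynomial.Chebyshev.S R ((2 * (k + 1) : ℕ) : ℤ)).eval x = 2 * (Nat.fib (2 * (k + 1) + 2) : R) - (Nat.fib (2 * (k + 1) + 1) : R) := by
      rw [show ((2 * (k + 1) : ℕ) : ℤ) = ((2 * k : ℕ) : ℤ) + 2 by push_cast; ring, Polynomial.Chebyshev.S_add_two, show ((2 * k : ℕ) : ℤ) + 1 = ((2 * k + 1 : ℕ) : ℤ) by push_cast; ring,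
        eval_sub, eval_mul, eval_X, ih1, ih0, show 2 * (k + 1) + 2 = 2 * k + 4 by ring, show 2 * (k + 1) + 1 = 2 * k + 3 by ring]
      linear_combination (Nat.fib (2 * k + 2) : R) * hx - 2 * f4 - f3
    refine ⟨heven, ?_⟩
    rw [show ((2 * (k + 1) + 1 : ℕ) : ℤ) = ((2 * k + 1 : ℕ) : ℤ) + 2 by push_cast; ring, Polynomial.Chebyshev.S_add_two, show ((2 * k + 1 : ℕ) : ℤ) + 1 = ((2 * (k + 1) : ℕ) : ℤ) by push_cast; ring,
      eval_sub, eval_mul, eval_X, heven, ih1, show 2 * (k + 1) + 2 = 2 * k + 4 by ring, show 2 * (k + 1) + 1 = 2 * k + 3 by ring]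
    linear_combination x * f4

/-- **`C_{2k+1}(√5) = F_{2k+1}·√5`** over `ℝ`. [Koshy 2001, Ch. 17; this file, §1291] -/
theorem chebyshevC_eval_sqrt_five_odd (k : ℕ) : (Polynomial.Chebyshev.C ℝ ((2 * k + 1 : ℕ) : ℤ)).eval (Real.sqrt 5) = Nat.fib (2 * k + 1) * Real.sqrt 5 :=
  (chebyshevC_eval_of_sq_eq_five (Real.sq_sqrt (by norm_num : (0 : ℝ) ≤ 5)) k).2

/-- **`S_{2k+1}(√5) = F_{2k+2}·√5`** over `ℝ`. [Koshy 2001, Ch. 17; this file, §1291] -/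
theorem chebyshevS_eval_sqrt_five_odd (k : ℕ) : (Polynomial.Chebyshev.S ℝ ((2 * k + 1 : ℕ) : ℤ)).eval (Real.sqrt 5) = Nat.fib (2 * k + 2) * Real.sqrt 5 :=
  (chebyshevS_eval_of_sq_eq_five (Real.sq_sqrt (by norm_num : (0 : ℝ) ≤ 5)) k).2

/-! ### A trigonometric product for `F_{2n+2}` -/

/-- **`F_{2n+2} = ∏_{k<n} (3 − 2cos((k+1)π∕(n+1)))`** (`S_n(3)` through the real factorisation of `S_n`, N500). [Garnier–Ramaré 2008; Koshy 2001, Ch. 17; this file, §1291] -/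
theorem fib_two_mul_add_two_eq_prod_cos (n : ℕ) : (Nat.fib (2 * n + 2) : ℝ) = ∏ k ∈ Finset.range n, (3 - 2 * Real.cos ((k + 1) * Real.pi / (n + 1))) := by
  rw [← chebyshevS_eval_three (R := ℝ) n, chebyshevS_eq_prod_real, eval_prod]
  exact Finset.prod_congr rfl fun k _ => by rw [eval_sub, eval_X, eval_C]

end Summit.Ventures.HSemireg.Wedge.HankelOuter
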